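import Literature.Probability.RandomPlanarGeometry.HexSAWStripWidthThreeFourthContactMoment
import Literature.Analysis.Asymptotics.FourthCentralMomentAlgebra
import HarnessLib

/-!
# The width-three strip at criticality: the FOURTH CUMULANT `m₄ − 3Var²` of the surface-contact count is linear in the length with rate the Bell constant
# `κ̂₄(T = 3)` per hat index, `κ₄ = κ̂₄/2` per step (module «WIDTH-THREE CONTACT KURTOSIS»)

Topic `Literature/Probability/RandomPlanarGeometry` (continues «WIDTH-THREE FOURTH CONTACT MOMENT» `HexSAWStripWidthThreeFourthContactMoment.lean` — the quartic law
`W3.exists_hatC4D_three_quartic`, the constants `W3.quartA/B/C/DThree`, `W3.cubP3/P2/P1Three`, the statistic `W3.fourthTopThree` and the Bell constant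
`W3.kappaHatFourThree` — and the model-free «FOURTH CENTRAL MOMENT ALGEBRA» `Literature.Analysis.tendsto_ratio_fourth_central_sub_linear`).  Lane «pcv-sawmu»
(CriticalPhenomena venture), a-p2 g29; the `T = 2` twin is «WIDTH-TWO CONTACT KURTOSIS» (`κ₄(T=2) = (3339420 − 2361331√2)/32`).  With `K = k + 1` the laws of
`D̂, Ĉ, Ĉ², Ĉ³, Ĉ⁴` are polynomials of degree `0…4` in `K`; the `K⁴, K³, K²` coefficients of `E = S₀A³ − 4P₀C₀A² − 3Q₀²A² + 12Q₀C₀²A − 6C₀⁴` vanish identically in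
the free intercepts `m₀, m₂, m₃`, the `K¹` coefficient is `κ̂₄·A⁴` with `κ̂₄` the Bell-formula constant (the intercepts cancel — `kurtRate_identity_three`; the four
identities were pre-verified as formal identities in the 19 free atoms by exact rational arithmetic, `HOME/pub-sawmu-a-p2/g29/kit/w3k4_identity_check.py`), whence
`fourthTopThree (K) − κ̂₄K → W`.  Numerically `κ₄(T=3) = κ̂₄/2 ≈ −1.1765` per step (kit series value; the closed form in `ℚ(x_c, y₃)` is the next module).
Frame: W. Feller I (1968) XIII.6; nothing below is printed.

## What is proved (namespace `…SAW.HV.W3`)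
* `quartic_cancellation_four/three/two_three` (the `K⁴, K³, K²` cancellations), ★ `kurtRate_identity_three` (slope `= κ̂₄`),
  ★★★ **`tendsto_fourthTopThree_sub_linear (a b : Fin (2*3)) : ∃ W, Tendsto (fun k => fourthTopThree (k+1) a b − kappaHatFourThree·(k+1)) atTop (𝓝 W)`**,
  `tendsto_fourthTopThree_div`, ★★★ `tendsto_fourthTopThree_div_hatLen` (per step `→ kappaStepFourThree`).

Label: LANE THEOREM (own result of lane «pcv-sawmu», a-p2 g29, 2026-08-28; not in print).
-/

noncomputable section

open Finset Filter Topology Literature.Probability.LatticeModels Literature.Probability.Percolation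

namespace Literature.Probability.RandomPlanarGeometry.SAW

namespace HV

namespace W3

/-! ## The kurtosis law of `S₃` -/

/-- `T_y = −c·T_λ` (plumbing). [cite: Feller1968, XIII.6; lane plumbing] -/
private theorem tyThree_eq_neg_mul (hT : tOneThree ≠ 0) : tyThree = -(cThree * tOneThree) := by
  have : cThree * tOneThree = -tyThree := by rw [cThree]; field_simp
  linarith

set_option maxHeartbeats 4000000 in
/-- The `K⁴`-cancellation of the kurtosis statistic (`s₄ = c⁴A`, plumbing). [cite: Feller1968, XIII.6; lane «pcv-sawmu» a-p2 g29] -/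
theorem quartic_cancellation_four_three (hT : tOneThree ≠ 0) (A : ℝ) :
    A ^ 3 * (quartAThree A / 4) - 4 * A ^ 2 * (cubP3Three A) * (cThree * A) - 3 * A ^ 2 * (cThree ^ 2 * A) ^ 2 + 12 * A * (cThree ^ 2 * A) * (cThree * A) ^ 2 - 6 * (cThree * A) ^ 4 = 0 := by
  simp only [quartAThree, quartSrc3Three, cubP3Three, cubAThree, cubSrc2Three, tyThree_eq_neg_mul hT]
  field_simp
  ring

set_option maxHeartbeats 4000000 in
/-- The `K³`-cancellation of the kurtosis statistic (plumbing). [cite: Feller1968, XIII.6; lane «pcv-sawmu» a-p2 g29] -/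
theorem quartic_cancellation_three_three (hT : tOneThree ≠ 0) (A m₀ : ℝ) :
    A ^ 3 * ((quartBThree A m₀ / 3 - quartAThree A / 2) - 4 * (quartAThree A / 4)) - 4 * A ^ 2 * ((cubP3Three A) * (m₀ - cThree * A) + (cubP2Three A m₀
        - 3 * cubP3Three A) * (cThree * A)) - 6 * A ^ 2 * (cThree ^ 2 * A) * (linQThree A m₀ - 2 * (cThree ^ 2 * A)) + 12 * A * (2 * (cThree ^ 2 * A) * (cThree * A) * (m₀
        - cThree * A) + (linQThree A m₀ - 2 * (cThree ^ 2 * A)) * (cThree * A) ^ 2) - 24 * (cThree * A) ^ 3 * (m₀ - cThree * A) = 0 := by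
  simp only [quartBThree, quartAThree, quartSrc2Three, quartSrc3Three, cubP2Three, cubP3Three, cubBThree, cubAThree, cubSrc1Three, cubSrc2Three,
    linQThree, tyThree_eq_neg_mul hT]
  field_simp
  ring

set_option maxHeartbeats 4000000 in
/-- The `K²`-cancellation of the kurtosis statistic (plumbing). [cite: Feller1968, XIII.6; lane «pcv-sawmu» a-p2 g29] -/
theorem quartic_cancellation_two_three (hT : tOneThree ≠ 0) (A m₀ m₂ : ℝ) :
    A ^ 3 * ((quartAThree A / 4 - quartBThree A m₀ / 2 + quartCThree A m₀ m₂ / 2) - 3 * (quartBThree A m₀ / 3 - quartAThree A / 2) + 6 * (quartAThree A / 4))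
        - 4 * A ^ 2 * ((cubP2Three A m₀ - 3 * cubP3Three A) * (m₀ - cThree * A) + (cubP1Three A m₀ m₂ - 2 * cubP2Three A m₀ + 3 * cubP3Three A) * (cThree * A))
        - 3 * A ^ 2 * ((linQThree A m₀ - 2 * (cThree ^ 2 * A)) ^ 2 + 2 * (cThree ^ 2 * A) * (m₂ - linQThree A m₀ + cThree ^ 2 * A)) + 12 * A * ((cThree ^ 2 * A) * (m₀
        - cThree * A) ^ 2 + 2 * (linQThree A m₀ - 2 * (cThree ^ 2 * A)) * (cThree * A) * (m₀ - cThree * A) + (m₂ - linQThree A m₀ + cThree ^ 2 * A) * (cThree * A) ^ 2)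
      - 36 * (cThree * A) ^ 2 * (m₀ - cThree * A) ^ 2 = 0 := by
  simp only [quartCThree, quartBThree, quartAThree, quartSrc1Three, quartSrc2Three, quartSrc3Three, cubP1Three, cubP2Three, cubP3Three,
    cubCThree, cubBThree, cubAThree, cubSrc0Three, cubSrc1Three, cubSrc2Three, linQThree, tyThree_eq_neg_mul hT]
  field_simp
  ring

set_option maxHeartbeats 8000000 in
/-- ★ The kurtosis-rate identity for `S₃`: the `K¹` coefficient of the statistic is `κ̂₄·A⁴` — the intercepts `m₀, m₂, m₃` cancel and the Bell formula appears.
[cite: Feller1968, XIII.6; lane «pcv-sawmu» a-p2 g29 — own] -/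
theorem kurtRate_identity_three (hT : tOneThree ≠ 0) {A : ℝ} (hA : A ≠ 0) (m₀ m₂ m₃ : ℝ) :
    (A ^ 3 * ((quartBThree A m₀ / 6 - quartCThree A m₀ m₂ / 2 + quartDThree A m₀ m₂ m₃) - 2 * (quartAThree A / 4 - quartBThree A m₀ / 2 + quartCThree A m₀ m₂ / 2)
        + 3 * (quartBThree A m₀ / 3 - quartAThree A / 2) - 4 * (quartAThree A / 4)) - 4 * A ^ 2 * ((cubP1Three A m₀ m₂ - 2 * cubP2Three A m₀ + 3 * cubP3Three A) * (m₀ - cThree * A)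
        + (m₃ - cubP1Three A m₀ m₂ + cubP2Three A m₀ - cubP3Three A) * (cThree * A)) - 6 * A ^ 2 * (linQThree A m₀ - 2 * (cThree ^ 2 * A)) * (m₂ - linQThree A m₀ + cThree ^ 2 * A)
        + 12 * A * ((linQThree A m₀ - 2 * (cThree ^ 2 * A)) * (m₀ - cThree * A) ^ 2 + 2 * (m₂ - linQThree A m₀ + cThree ^ 2 * A) * (cThree * A) * (m₀ - cThree * A))
        - 24 * (cThree * A) * (m₀ - cThree * A) ^ 3) / A ^ 4
      = kappaHatFourThree := by
  rw [div_eq_iff (pow_ne_zero 4 hA)]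
  simp only [quartDThree, quartCThree, quartBThree, quartAThree, quartSrc0Three, quartSrc1Three, quartSrc2Three, quartSrc3Three, cubP1Three, cubP2Three, cubP3Three,
    cubCThree, cubBThree, cubAThree, cubSrc0Three, cubSrc1Three, cubSrc2Three, linQThree, kappaHatFourThree, kappaHatThree, cThreeThree, cTwoThree, tyThree_eq_neg_mul hT]
  field_simp
  ring

set_option maxHeartbeats 1600000 in
/-- ★★★ **THE WIDTH-TWO CONTACT KURTOSIS LAW**: for every pair of levels `a, b` there is `W` with `fourthTopThree (k+1) a b − κ̂₄·(k+1) → W` (`κ̂₄ = kappaHatFourThree`):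
the fourth cumulant `m₄ − 3Var²` of the surface-contact count is linear in the length.
[cite: Feller1968, XIII.6 (moments of the number of renewals); DuminilCopinHammond2013, §2.2; lane «pcv-sawmu» a-p2 g29 — own result, not in print] -/
theorem tendsto_fourthTopThree_sub_linear (a b : Fin (2 * 3)) :
    ∃ W : ℝ, Tendsto (fun k : ℕ => fourthTopThree (k + 1) a b - kappaHatFourThree * ((k : ℝ) + 1)) atTop (𝓝 W) := by
  obtain ⟨m₀, m₂, m₃, m₄, K, hb₁, hb₂, hb₃, hb₄⟩ := exists_hatC4D_three_quartic a b
  have hT : tOneThree ≠ 0 := (exists_hatCD_three_linear a b).1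
  obtain ⟨K₀, hK₀⟩ := abs_hatD_three_sub_lim_le
  have hR0 : (0 : ℝ) < 97 / 100 := by norm_num
  have hR1 : (97 / 100 : ℝ) < 1 := by norm_num
  set A : ℝ := limDThree a b with hA
  have hApos : 0 < A := limDThree_pos a b
  have hAne : A ≠ 0 := hApos.ne'
  have hD : Tendsto (fun k : ℕ => ((k : ℝ) + 1) ^ 4 * (hatD 3 (stripYT 3) (k + 1) a b - A)) atTop (𝓝 0) :=
    Literature.Analysis.tendsto_succ_pow_mul_of_abs_le (e := fun n => hatD 3 (stripYT 3) (n + 1) a b - A) hR0 hR1 (fun n => hK₀ a b n) 4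
  have hC : Tendsto (fun k : ℕ => ((k : ℝ) + 1) ^ 3 * (hatCD (stripYT 3) (k + 1) a b - ((cThree * A) * ((k : ℝ) + 1) + (m₀ - cThree * A)))) atTop (𝓝 0) := by
    have h := Literature.Analysis.tendsto_succ_pow_mul_of_abs_le (e := fun n => hatCD (stripYT 3) (n + 1) a b - (cThree * A * (n : ℝ) + m₀)) hR0 hR1 hb₁ 3
    refine h.congr fun k => ?_
    ring
  have hQ : Tendsto (fun k : ℕ => ((k : ℝ) + 1) ^ 2 * (hatC2D (stripYT 3) (k + 1) a b - ((cThree ^ 2 * A) * ((k : ℝ) + 1) ^ 2 + (linQThree A m₀ - 2 * (cThree ^ 2 * A)) * ((k : ℝ) + 1)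
      + (m₂ - linQThree A m₀ + cThree ^ 2 * A)))) atTop (𝓝 0) := by
    have h := Literature.Analysis.tendsto_succ_pow_mul_of_abs_le (e := fun n => hatC2D (stripYT 3) (n + 1) a b - (cThree ^ 2 * A * (n : ℝ) ^ 2 + linQThree A m₀ * (n : ℝ) + m₂)) hR0 hR1 hb₂ 2
    refine h.congr fun k => ?_
    ring
  have hP : Tendsto (fun k : ℕ => ((k : ℝ) + 1) * (hatC3D (stripYT 3) (k + 1) a b - ((cubP3Three A) * ((k : ℝ) + 1) ^ 3 + (cubP2Three A m₀ - 3 * cubP3Three A) * ((k : ℝ) + 1) ^ 2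
      + (cubP1Three A m₀ m₂ - 2 * cubP2Three A m₀ + 3 * cubP3Three A) * ((k : ℝ) + 1) + (m₃ - cubP1Three A m₀ m₂ + cubP2Three A m₀ - cubP3Three A)))) atTop (𝓝 0) := by
    have h := Literature.Analysis.tendsto_succ_pow_mul_of_abs_le (e := fun n => hatC3D (stripYT 3) (n + 1) a b - (cubP3Three A * (n : ℝ) ^ 3 + cubP2Three A m₀ * (n : ℝ) ^ 2
        + cubP1Three A m₀ m₂ * (n : ℝ) + m₃)) hR0 hR1 hb₃ 1
    simp only [pow_one] at h
    refine h.congr fun k => ?_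
    ring
  have hS : Tendsto (fun k : ℕ => hatC4D (stripYT 3) (k + 1) a b - ((quartAThree A / 4) * ((k : ℝ) + 1) ^ 4 + ((quartBThree A m₀ / 3 - quartAThree A / 2)
      - 4 * (quartAThree A / 4)) * ((k : ℝ) + 1) ^ 3 + ((quartAThree A / 4 - quartBThree A m₀ / 2 + quartCThree A m₀ m₂ / 2) - 3 * (quartBThree A m₀ / 3 - quartAThree A / 2)
      + 6 * (quartAThree A / 4)) * ((k : ℝ) + 1) ^ 2 + ((quartBThree A m₀ / 6 - quartCThree A m₀ m₂ / 2 + quartDThree A m₀ m₂ m₃) - 2 * (quartAThree A / 4 - quartBThree A m₀ / 2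
      + quartCThree A m₀ m₂ / 2) + 3 * (quartBThree A m₀ / 3 - quartAThree A / 2) - 4 * (quartAThree A / 4)) * ((k : ℝ) + 1) + (m₄ - (quartBThree A m₀ / 6 - quartCThree A m₀ m₂ / 2
      + quartDThree A m₀ m₂ m₃) + (quartAThree A / 4 - quartBThree A m₀ / 2 + quartCThree A m₀ m₂ / 2) - (quartBThree A m₀ / 3 - quartAThree A / 2)
      + (quartAThree A / 4)))) atTop (𝓝 0) := by
    have h := Literature.Analysis.tendsto_succ_pow_mul_of_abs_le (e := fun n => hatC4D (stripYT 3) (n + 1) a b - (quartAThree A / 4 * (n : ℝ) ^ 4 + (quartBThree A m₀ / 3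
        - quartAThree A / 2) * (n : ℝ) ^ 3 + (quartAThree A / 4 - quartBThree A m₀ / 2 + quartCThree A m₀ m₂ / 2) * (n : ℝ) ^ 2 + (quartBThree A m₀ / 6 - quartCThree A m₀ m₂ / 2
        + quartDThree A m₀ m₂ m₃) * (n : ℝ) + m₄)) hR0 hR1 hb₄ 0
    simp only [pow_zero, one_mul] at h
    refine h.congr fun k => ?_
    ring
  have h4 := quartic_cancellation_four_three hT A
  have h3 := quartic_cancellation_three_three hT A m₀
  have h2 := quartic_cancellation_two_three hT A m₀ m₂
  have h := Literature.Analysis.tendsto_ratio_fourth_central_sub_linear (D := fun k => hatD 3 (stripYT 3) (k + 1) a b)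
    (C := fun k => hatCD (stripYT 3) (k + 1) a b) (Q := fun k => hatC2D (stripYT 3) (k + 1) a b) (P := fun k => hatC3D (stripYT 3) (k + 1) a b)
    (S := fun k => hatC4D (stripYT 3) (k + 1) a b) hAne h4 h3 h2 hD hC hQ hP hS
  rw [kurtRate_identity_three hT hAne m₀ m₂ m₃] at h
  refine ⟨_, h.congr fun k => ?_⟩
  simp only [fourthTopThree, meanTopThree]

/-- Corollary: `fourthTopThree k a b / k → κ̂₄`. [cite: Feller1968, XIII.6; lane «pcv-sawmu» a-p2 g29] -/
theorem tendsto_fourthTopThree_div (a b : Fin (2 * 3)) :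
    Tendsto (fun k : ℕ => fourthTopThree k a b / (k : ℝ)) atTop (𝓝 kappaHatFourThree) := by
  obtain ⟨W, h⟩ := tendsto_fourthTopThree_sub_linear a b
  have hinv : Tendsto (fun k : ℕ => ((k : ℝ) + 1)⁻¹) atTop (𝓝 0) := by
    have := (tendsto_one_div_add_atTop_nhds_zero_nat : Tendsto (fun n : ℕ => 1 / ((n : ℝ) + 1)) atTop (𝓝 0))
    simpa using this
  have t := (h.mul hinv).add_const kappaHatFourThree
  rw [mul_zero, zero_add] at t
  have t' : Tendsto (fun k : ℕ => fourthTopThree (k + 1) a b / (((k + 1 : ℕ) : ℝ))) atTop (𝓝 kappaHatFourThree) := by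
    refine t.congr fun k => ?_
    have hk : ((k : ℝ) + 1) ≠ 0 := by positivity
    push_cast
    field_simp
    ring
  exact (tendsto_add_atTop_iff_nat 1).1 t'

/-- ★★★ **PER STEP**: `fourthTopThree k a b / (number of steps) → κ₄(T=3) = kappaStepFourThree` (`= (3339420 − 2361331√2)/32`, §2) for every pair of end levels.
[cite: Feller1968, XIII.6; DuminilCopinHammond2013, §2.2; lane «pcv-sawmu» a-p2 g29 — own result, not in print] -/
theorem tendsto_fourthTopThree_div_hatLen (a b : Fin (2 * 3)) :
    Tendsto (fun k : ℕ => fourthTopThree k a b / ((hatLen k a b : ℤ) : ℝ)) atTop (𝓝 kappaStepFourThree) := by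
  have t := (tendsto_fourthTopThree_div a b).mul (tendsto_div_hatLen_three a b)
  rw [show kappaHatFourThree * (1 / 2) = kappaStepFourThree by rw [kappaStepFourThree]; ring] at t
  refine t.congr' ?_
  filter_upwards [eventually_gt_atTop 0] with k hk
  have hk' : (k : ℝ) ≠ 0 := by exact_mod_cast hk.ne'
  field_simp

end W3

end HV

end Literature.Probability.RandomPlanarGeometry.SAW
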